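import Literature.MathematicalPhysics.QuantumFieldTheory.Balaban1983to89.B9Eq342CombesThomasBlockForm
import Literature.MathematicalPhysics.QuantumFieldTheory.Balaban1983to89.B9Thm311CoerciveCompactZd

/-!
# `Balaban1983to89.B9Thm33GDecayOfCoerciveZd` — [Balaban1985BackgroundPropagators] Thm 3.3 p. 399 ∕ (3.42) FOR THE GENUINE `G_𝔤(U₀) = (Ω₀Δ_a(U₀)Ω₀)⁻¹` OF
# (3.26)–(3.27) ON THE HERMITIAN SUB-CARRIER `E_𝔤(Ω₀)` OF THE `ℤᵈ` FRAME, n = 0 SHAPE, REDUCED TO TWO DISPLAYED INPUTS: a COERCIVITY constant `c` of `Δ_a(U₀)` on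
# `E_𝔤(Ω₀)` (Thm 3.11 ∕ [4] p. 226 in quantitative currency — dag-n06-w4 g4's `B9Thm311CoerciveCompactZd` per member) and an ALMOST-LOCAL BLOCK MAJORANT of
# `Δ_a(U₀)↾E_𝔤(Ω₀)` (the entry decay of `D*D + Δ′ + D R 𝟙 D* + Q*aQ` — its `D R 𝟙 D*` part is the deep input, stations 2–3):
# ★★★ `|(G_𝔤(U₀)δ_b w)(b′)|_τ ≤ e^{−κ|b′−b|_∞}·|w|_τ ∕ (c − ϱ)` by the carrier-generic engine `B9Eq342CombesThomasBlockForm`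

statement-level skeleton of published theorems with citation tags; proofs where landed; nothing here is a claim about the
Yang–Mills mass gap

`[Balaban1985BackgroundPropagators]` ("B9", CMP **99** (1985) 389–434): Thm 3.3 p. 399 (for `U` in the class (3.35) the operator `G(U)` satisfies the inequalities
(3.42)–(3.47) of Thm 3.1 with its own constants), (3.42) p. 397 *«|(G′(U)λ)(x)| ≦ B₀(Lʲη)²e^{−δ₀d(y,y′)}|λ| for x ∈ Δ(y), y ∈ Λ_j, supp λ ⊂ Δ(y′)»*; (3.26)–(3.27) p. 395
(`Δ_a = Δ + DRD* + Q*aQ`, `G = (Δ_a↾Ω₀)⁻¹`); Thm 3.11 p. 416; Thm 3.10 (3.107)–(3.108) pp. 415–416 (print's own road: the random-walk expansion `G = Σ_ω …`);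
[Balaban1984PropagatorsII] p. 226.  HERE: the n = 0 entry's SHAPE for the genuine `G_𝔤` at a finite member from the two displayed inputs by the Combes–Thomas
conjugation — the route's substitute for (3.107); print's constants `O(1)(Lʲη)²`, `δ₀` (uniform in the member) are NOT claimed.

CITATION HEADER (lean-in-tree rule).  Cell `pub-ymgap` (YM Track A, HUMAN RULING D-0062 ∕ D-0149 width push), DAG node N06 = [B9], width seat
`pub-ymgap-dag-n06-w2` (g4), CLAIM-3 FILE D = COORD-2's (D) «station 5» (dag-n06-w4 g4 GO, bus 2026-08-28T09:13Z: «engine yours, constants mine»).  Inputs BY NAME: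
the engine (this seat, FILE C), dag-n06-b g18's Hermitian sub-carrier `B9Eq327GreenZdHerm.{domSubH, RegularAtH, deltaAEquivH, gopZdH, restrictLinH}`,
dag-n06-w4 g2's `bondPair ∕ domSub ∕ bondPair_restrictDom_right`, dag-n06-b's `B9Thm311FlatHermKernelZd.bondPair_eq_sum_of_vanish_off`, `B7Prop5Flat.bump`,
`LatticeNorms.linfDist`, dag-n06-w4 g4's constants `B9Thm311CoerciveCompactZd.exists_coercive_of_pdevOn_lt_cube` and dag-n06-b g19's
`B9Thm311PerMemberCubeZdUnconditional.regularAtH_of_pdevOn_lt_cube` (§4).  Nothing restated.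

WHAT IS DECLARED ∕ PROVED (kernel, 0 sorry; three small definitions with bodies + theorems; no `instance`, no `notation`).
* §1 the dictionary `E_𝔤(Ω₀) ↔` the engine: `coordH Ω₀ b` (`A ↦ A(b)` into the self-adjoint part `𝔰 = selfAdjoint.submodule ℝ 𝔸`), `bumpH Ω₀ b` (`w ↦ δ_b w` for a
  bond `b` of `Ω₀`, `0` otherwise), `fibreH τ` (`Re τ(a*b)` on `𝔰`); `coordH_bumpH_self ∕ _of_ne`, `sum_bumpH_coordH` (reconstruction over the bonds of `Ω₀`),
  `bsize_fibreH` (`= fnorm τ`), `cform_fibreH_eq_bondPair` (the engine's carrier form IS `⟨·,·⟩_τ` on `E_𝔤(Ω₀)`).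
* §2 ★★ `blk_deltaAEquivH` (the engine's block of `Δ_a↾E_𝔤(Ω₀)` is `(Δ_a(U₀)δ_{b′}w)(b)`), `cform_deltaAEquivH_eq_bondPair` (its form is `⟨A, Δ_a(U₀)A⟩_τ`),
  `gopZdH_bump_eq_symm` (`G_𝔤(U₀)δ_b w` is the engine's solution `g`).
* §3 ★★★ `fnorm_gopZdH_bump_le_exp_of_coercive` — ANY letter record `o`, finite `Ω₀`, faithful Hermitian `τ`, `RegularAtH`: a coercivity constant
  `c·⟨A,A⟩_τ ≤ ⟨A, Δ_a(U₀)A⟩_τ` on `E_𝔤(Ω₀)` + a block majorant `|(Δ_a(U₀)δ_{b′}w)(b)|_τ ≤ A(b,b′)|w|_τ` on the bonds of `Ω₀` with `(e^{κ|·|_∞} − 1)`-weighted row and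
  column sums `≤ ϱ < c` ⟹ for all bonds `b, b′` of `Ω₀` and Hermitian `w`: `|(G_𝔤(U₀)δ_{b′}w)(b)|_τ ≤ e^{−κ|b−b′|_∞}·|w|_τ ∕ (c − ϱ)`;
  ★★ `…_of_range` (finite-range majorant: `a`, `r`, ball count `N`).
* §4 ★★★ `exists_fnorm_gopZdH_bump_le_exp_cube` — AT A CUBE MEMBER for the genuine four-letter `opsAllZd` at print's class `cubeLamBP`: dag-n06-w4 g4's `α, c` and
  dag-n06-b g19's regularity make the coercivity and `RegularAtH` inputs THEOREMS for every unitary `U₀` with `pdevOn(□₀ ± 3) U₀ < α`; the block majorant of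
  `Δ_a(U₀)` stays DISPLAYED (rows∕columns `≤ ϱ < c`) ⟹ the same decay.

HONEST SCOPE.  A REDUCTION: the n = 0 entry of (3.42) for the GENUINE `G_𝔤(U₀)` ⟸ {coercivity constant (per member, dag-n06-w4 g4: compactness, non-quantitative),
almost-local majorant of `Δ_a(U₀)` (DISPLAYED — `D*D`, `Δ′`, `Q*aQ` are finite-range and typable, `D R 𝟙 D*` needs the decay of `G′` and `(Q′G′²Q′*)⁻¹`, stations
1–3)}; rate and constant are the window's, NOT print's; nothing uniform in the member; the gradient ∕ Hölder entries (3.43)–(3.47) untouched.  Count-neutral;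
N05 ∕ N06 NOT discharged; K1⁸ `stmt-QuantumFields-26907` NOT closed; one finite `𝕋⁴` programme at fixed `ε`, Bałaban as printed; R4 closes only the conditional
finite-`𝕋⁴` rung `BalabanLadder.UV` — nothing continuum ∕ ℝ⁴ ∕ OS ∕ mass gap ∕ Clay.  Unit `pub-ymgap-dag-n06-w2` (g4), 2026-08-28.
-/

noncomputable section

open scoped BigOperators

namespace Literature.MathematicalPhysics.QuantumFieldTheory.Balaban1983to89.B9Thm33GDecayOfCoerciveZd

open B7Prop1Local (pdevOn)
open B7Prop2Explicit (unitaryUnits)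
open B7Prop5Flat (bump)
open B8Ineq132 (BondTouches)
open B8Eq131Cubes (sqLo sqHi)
open B8Eq131CubesAdmissible (cubeFam)
open B8CubeMemberZd (cubeLamS)
open B8Ineq159FlatCubeMemberPrinted (cubeLamBP)
open B8LeafModelZd (ZdIdx)
open B9SupplySockB9P3ZdLetters (OpsZd deltaAOf)
open B9SupplySockB9P3ZdAllLettersZd (opsAllZd)
open B9Eq327GreenZd (domSub bondPair bondPair_restrictDom_right setOf_bondTouches_finite)
open B9Eq327GreenZdHerm (domSubH domSubH_le mem_domSubH_iff RegularAtH deltaAEquivH deltaAEquivH_coe gopZdH gopZdH_of_regularAtH restrictLinH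
  restrictLinH_coe_of_herm)
open B9SupplySockB9P3ZdLettersOmega (restrictDom restrictDom_of restrictDom_of_not)
open B9Thm311FlatHermKernelZd (bondPair_eq_sum_of_vanish_off)
open B9Eq342CombesThomasFormZd (fnorm fnorm_nonneg)
open B9Eq342CombesThomasBlockForm
open LatticeNorms (linfDist)

export B7Prop1Explicit (Site)

variable {d : ℕ} {𝔸 : Type*} [CStarAlgebra 𝔸]

/-! ## §1  The dictionary: `E_𝔤(Ω₀)` read through its bond coordinates -/

section Dictionary

variable (Ω₀ : Set (Site d)) (τ : 𝔸 →ₗ[ℂ] ℂ)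

/-- **THE BOND COORDINATE** `A ↦ A(b)` of `E_𝔤(Ω₀)` into the self-adjoint part `𝔰` of the fibre.
[cite: Balaban1985BackgroundPropagators, (3.27) p.395, p.391 («𝔤-valued configurations»)] -/
def coordH (b : Site d × Fin d) : domSubH (𝔸 := 𝔸) Ω₀ →ₗ[ℝ] selfAdjoint.submodule ℝ 𝔸 where
  toFun A := ⟨(A : Site d → Fin d → 𝔸) b.1 b.2, A.2.2 b.1 b.2⟩
  map_add' _ _ := rfl
  map_smul' _ _ := rfl

/-- `coordH`, unfolded. [cite: Balaban1985BackgroundPropagators, (3.27) p.395 (bookkeeping)] -/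
@[simp] theorem coordH_coe (b : Site d × Fin d) (A : domSubH (𝔸 := 𝔸) Ω₀) :
    ((coordH Ω₀ b A : selfAdjoint.submodule ℝ 𝔸) : 𝔸) = (A : Site d → Fin d → 𝔸) b.1 b.2 := rfl

/-- the single-bond Hermitian field `δ_b w` lies in `E_𝔤(Ω₀)` for a bond `b` of `Ω₀`. [cite: Balaban1985BackgroundPropagators, (3.27) p.395 (bookkeeping)] -/
theorem bump_mem_domSubH {b : Site d × Fin d} (hb : BondTouches Ω₀ b.1 b.2) (w : selfAdjoint.submodule ℝ 𝔸) :
    bump b.1 b.2 (w : 𝔸) ∈ domSubH (𝔸 := 𝔸) Ω₀ := by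
  refine ⟨fun y μ hyμ => ?_, fun y μ => ?_⟩
  · have hne : ¬ (y = b.1 ∧ μ = b.2) := fun h => hyμ (by rw [h.1, h.2]; exact hb)
    exact B7Prop5Flat.bump_eq_zero_of _ hne
  · by_cases h : y = b.1 ∧ μ = b.2
    · simp only [bump, if_pos h]; exact w.2
    · rw [B7Prop5Flat.bump_eq_zero_of _ h]; exact IsSelfAdjoint.zero _

open Classical in
/-- **THE SINGLE-BOND INJECTION** `w ↦ δ_b w` into `E_𝔤(Ω₀)` for a bond `b` of `Ω₀` (and `0` for the other bonds, which carry no coordinate of `E_𝔤(Ω₀)`).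
[cite: Balaban1985BackgroundPropagators, (3.27) p.395; Balaban1985Averaging, (137)–(138) p.39 (the single-bond variation)] -/
def bumpH (b : Site d × Fin d) : selfAdjoint.submodule ℝ 𝔸 →ₗ[ℝ] domSubH (𝔸 := 𝔸) Ω₀ :=
  if hb : BondTouches Ω₀ b.1 b.2 then
    { toFun := fun w => ⟨bump b.1 b.2 (w : 𝔸), bump_mem_domSubH Ω₀ hb w⟩
      map_add' := fun w w' => by
        apply Subtype.ext; funext y μ
        simp only [Submodule.coe_add, Pi.add_apply, bump]
        split_ifs <;> simp
      map_smul' := fun c w => by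
        apply Subtype.ext; funext y μ
        simp only [Submodule.coe_smul, Pi.smul_apply, RingHom.id_apply, bump]
        split_ifs <;> simp }
  else 0

/-- `bumpH` on a bond of `Ω₀`, unfolded. [cite: Balaban1985BackgroundPropagators, (3.27) p.395 (bookkeeping)] -/
theorem bumpH_coe {b : Site d × Fin d} (hb : BondTouches Ω₀ b.1 b.2) (w : selfAdjoint.submodule ℝ 𝔸) :
    ((bumpH Ω₀ b w : domSubH (𝔸 := 𝔸) Ω₀) : Site d → Fin d → 𝔸) = bump b.1 b.2 (w : 𝔸) := by
  rw [bumpH, dif_pos hb]; rfl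

/-- `π_b(δ_b w) = w`. [cite: Balaban1985BackgroundPropagators, (3.27) p.395 (bookkeeping)] -/
theorem coordH_bumpH_self {b : Site d × Fin d} (hb : BondTouches Ω₀ b.1 b.2) (w : selfAdjoint.submodule ℝ 𝔸) :
    coordH Ω₀ b (bumpH Ω₀ b w) = w := by
  apply Subtype.ext
  rw [coordH_coe, bumpH_coe Ω₀ hb]
  simp [bump]

/-- `π_b(δ_{b′} w) = 0` for `b ≠ b′`. [cite: Balaban1985BackgroundPropagators, (3.27) p.395 (bookkeeping)] -/
theorem coordH_bumpH_of_ne {b b' : Site d × Fin d} (hb' : BondTouches Ω₀ b'.1 b'.2) (hne : b ≠ b') (w : selfAdjoint.submodule ℝ 𝔸) :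
    coordH Ω₀ b (bumpH Ω₀ b' w) = 0 := by
  apply Subtype.ext
  rw [coordH_coe, bumpH_coe Ω₀ hb']
  have h : ¬ (b.1 = b'.1 ∧ b.2 = b'.2) := fun h => hne (Prod.ext h.1 h.2)
  exact B7Prop5Flat.bump_eq_zero_of _ h

/-- **RECONSTRUCTION**: `Σ_{b ∈ bonds(Ω₀)} δ_b (A(b)) = A` for `A ∈ E_𝔤(Ω₀)` and any finite set `S` of bonds of `Ω₀` carrying `A`.
[cite: Balaban1985BackgroundPropagators, (3.27) p.395 (bookkeeping)] -/
theorem sum_bumpH_coordH (S : Finset (Site d × Fin d)) (hS : ∀ b ∈ S, BondTouches Ω₀ b.1 b.2)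
    (hS' : ∀ b : Site d × Fin d, BondTouches Ω₀ b.1 b.2 → b ∈ S) (A : domSubH (𝔸 := 𝔸) Ω₀) :
    ∑ b ∈ S, bumpH Ω₀ b (coordH Ω₀ b A) = A := by
  classical
  apply Subtype.ext
  rw [AddSubmonoidClass.coe_finsetSum]
  funext y μ
  rw [Finset.sum_apply, Finset.sum_apply]
  by_cases hb : BondTouches Ω₀ y μ
  · rw [Finset.sum_eq_single_of_mem (y, μ) (hS' (y, μ) hb)]
    · rw [bumpH_coe Ω₀ hb, coordH_coe]; simp [bump]
    · intro b hbS hne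
      rw [bumpH_coe Ω₀ (hS b hbS), coordH_coe]
      have h : ¬ (y = b.1 ∧ μ = b.2) := fun h => hne (Prod.ext h.1.symm h.2.symm)
      exact B7Prop5Flat.bump_eq_zero_of _ h
  · rw [A.2.1 y μ hb]
    refine Finset.sum_eq_zero fun b hbS => ?_
    rw [bumpH_coe Ω₀ (hS b hbS), coordH_coe]
    have h : ¬ (y = b.1 ∧ μ = b.2) := fun h => hb (by rw [h.1, h.2]; exact hS b hbS)
    exact B7Prop5Flat.bump_eq_zero_of _ h

/-- **THE FIBRE FORM ON THE SELF-ADJOINT PART**: `Re τ(a*b)` restricted to `𝔰`. [cite: Balaban1985BackgroundPropagators, p.391 («X·Y = tr XY»)] -/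
def fibreH : LinearMap.BilinForm ℝ (selfAdjoint.submodule ℝ 𝔸) :=
  (B9Eq324DeltaPrimeAZd.fibreForm τ).restrict (selfAdjoint.submodule ℝ 𝔸)

/-- `fibreH`, unfolded. [cite: Balaban1985BackgroundPropagators, p.391 (bookkeeping)] -/
@[simp] theorem fibreH_apply (u v : selfAdjoint.submodule ℝ 𝔸) : fibreH τ u v = (τ (star (u : 𝔸) * (v : 𝔸))).re := rfl

/-- the engine's fibre size is `|·|_τ`. [cite: Balaban1985BackgroundPropagators, p.390 (bookkeeping)] -/
theorem bsize_fibreH (w : selfAdjoint.submodule ℝ 𝔸) : bsize (fibreH τ) w = fnorm τ (w : 𝔸) := rfl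

/-- `fibreH` is symmetric for a Hermitian `τ`. [cite: Balaban1985BackgroundPropagators, p.391 (bookkeeping)] -/
theorem fibreH_comm (hτs : ∀ a : 𝔸, τ (star a) = starRingEnd ℂ (τ a)) (u v : selfAdjoint.submodule ℝ 𝔸) : fibreH τ u v = fibreH τ v u := by
  rw [fibreH_apply, fibreH_apply, ← B9Eq324DeltaPrimeAZd.fibreForm_apply, B9Eq324DeltaPrimeAZd.fibreForm_comm τ hτs, B9Eq324DeltaPrimeAZd.fibreForm_apply]

/-- `fibreH` is non-negative for a faithful `τ`. [cite: Balaban1985BackgroundPropagators, p.390 (bookkeeping)] -/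
theorem fibreH_self_nonneg (hτp : ∀ a : 𝔸, a ≠ 0 → 0 < (τ (star a * a)).re) (v : selfAdjoint.submodule ℝ 𝔸) : 0 ≤ fibreH τ v v := by
  rw [fibreH_apply]
  by_cases h : (v : 𝔸) = 0
  · rw [h, mul_zero, map_zero, Complex.zero_re]
  · exact (hτp _ h).le

/-- ★ **THE ENGINE'S CARRIER FORM IS `⟨·,·⟩_τ` ON `E_𝔤(Ω₀)`**: for the finite set `S` of ALL bonds of `Ω₀`, `Σ_{b∈S} Re τ(A(b)*B(b)) = bondPair τ A B`.
[cite: Balaban1985BackgroundPropagators, (3.17) p.393, (3.27) p.395] -/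
theorem cform_fibreH_eq_bondPair (S : Finset (Site d × Fin d)) (hS' : ∀ b : Site d × Fin d, BondTouches Ω₀ b.1 b.2 → b ∈ S) (A B : domSubH (𝔸 := 𝔸) Ω₀) :
    cform (fibreH τ) (coordH Ω₀) S A B = bondPair τ (A : Site d → Fin d → 𝔸) (B : Site d → Fin d → 𝔸) := by
  rw [bondPair_eq_sum_of_vanish_off τ S (fun b hb => A.2.1 b.1 b.2 (fun h => hb (hS' b h))) (B : Site d → Fin d → 𝔸)]
  rfl

end Dictionary

/-! ## §2  The blocks of `Δ_a(U₀)↾E_𝔤(Ω₀)` and the solution `G_𝔤(U₀)δ_b w` in the engine's letters -/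

section Blocks

variable (η : ℝ) (o : OpsZd d 𝔸) (Ω₀ : Set (Site d)) (U₀ : Site d → Fin d → 𝔸ˣ) (τ : 𝔸 →ₗ[ℂ] ℂ)

/-- ★★ **THE ENGINE's BLOCK OF `Δ_a(U₀)↾E_𝔤(Ω₀)` IS `(Δ_a(U₀)δ_{b′}w)(b)`** on bonds `b, b′` of `Ω₀` (through `RegularAtH`'s operator `Φ`, which acts as `Ω₀Δ_a(U₀)Ω₀`).
[cite: Balaban1985BackgroundPropagators, (3.26)–(3.27) p.395] -/
theorem blk_deltaAEquivH (h : RegularAtH η o Ω₀ U₀) {b b' : Site d × Fin d} (hb : BondTouches Ω₀ b.1 b.2) (hb' : BondTouches Ω₀ b'.1 b'.2)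
    (w : selfAdjoint.submodule ℝ 𝔸) :
    ((blk (coordH Ω₀) (bumpH Ω₀) (deltaAEquivH η o Ω₀ U₀ h).toLinearMap b b' w : selfAdjoint.submodule ℝ 𝔸) : 𝔸) =
      deltaAOf η o U₀ (bump b'.1 b'.2 (w : 𝔸)) b.1 b.2 := by
  rw [blk, coordH_coe, LinearEquiv.coe_toLinearMap, deltaAEquivH_coe, bumpH_coe Ω₀ hb', B9Eq327GreenZd.deltaADom, restrictDom_of _ hb]

/-- **THE ENGINE's FORM OF `Φ` IS `⟨A, Δ_a(U₀)A⟩_τ`.** [cite: Balaban1985BackgroundPropagators, (3.27) p.395, Thm 3.11 p.416] -/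
theorem cform_deltaAEquivH_eq_bondPair (h : RegularAtH η o Ω₀ U₀) (S : Finset (Site d × Fin d))
    (hS' : ∀ b : Site d × Fin d, BondTouches Ω₀ b.1 b.2 → b ∈ S) (A : domSubH (𝔸 := 𝔸) Ω₀) :
    cform (fibreH τ) (coordH Ω₀) S A ((deltaAEquivH η o Ω₀ U₀ h).toLinearMap A) =
      bondPair τ (A : Site d → Fin d → 𝔸) (deltaAOf η o U₀ (A : Site d → Fin d → 𝔸)) := by
  rw [cform_fibreH_eq_bondPair Ω₀ τ S hS', LinearEquiv.coe_toLinearMap, deltaAEquivH_coe, B9Eq327GreenZd.deltaADom,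
    bondPair_restrictDom_right τ (domSubH_le Ω₀ A.2)]

/-- **`G_𝔤(U₀)δ_b w` IS THE ENGINE's SOLUTION** `g = Φ⁻¹(σ_b w)` (bond `b` of `Ω₀`, Hermitian `w`). [cite: Balaban1985BackgroundPropagators, (3.27) p.395] -/
theorem gopZdH_bump_eq_symm (h : RegularAtH η o Ω₀ U₀) {b : Site d × Fin d} (hb : BondTouches Ω₀ b.1 b.2) (w : selfAdjoint.submodule ℝ 𝔸) :
    gopZdH η o Ω₀ U₀ (bump b.1 b.2 (w : 𝔸)) = (((deltaAEquivH η o Ω₀ U₀ h).symm (bumpH Ω₀ b w) : domSubH (𝔸 := 𝔸) Ω₀) : Site d → Fin d → 𝔸) := by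
  rw [gopZdH_of_regularAtH η o Ω₀ U₀ h]
  congr 2
  apply Subtype.ext
  have hherm : ∀ (y : Site d) (μ : Fin d), BondTouches Ω₀ y μ → IsSelfAdjoint (bump b.1 b.2 (w : 𝔸) y μ) :=
    fun y μ _ => (bump_mem_domSubH Ω₀ hb w).2 y μ
  rw [restrictLinH_coe_of_herm Ω₀ hherm, bumpH_coe Ω₀ hb]
  funext y μ
  by_cases hyμ : BondTouches Ω₀ y μ
  · rw [restrictDom_of _ hyμ]
  · rw [restrictDom_of_not _ hyμ, (bump_mem_domSubH Ω₀ hb w).1 y μ hyμ]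

end Blocks

/-! ## §3  ★★★ The n = 0 entry of (3.42) for the genuine `G_𝔤(U₀)` from a coercivity constant and a block majorant -/

section Decay

variable (η : ℝ) (o : OpsZd d 𝔸) {Ω₀ : Set (Site d)} (U₀ : Site d → Fin d → 𝔸ˣ) (τ : 𝔸 →ₗ[ℂ] ℂ)

/-- ★★★ **[B9] THM 3.3's (3.42), n = 0 SHAPE, FOR THE GENUINE `G_𝔤(U₀) = (Ω₀Δ_a(U₀)Ω₀)⁻¹` ON `E_𝔤(Ω₀)`, FROM A COERCIVITY CONSTANT AND AN ALMOST-LOCAL MAJORANT.**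
ANY letter record `o`, finite `Ω₀`, faithful Hermitian `τ`, `RegularAtH` (Thm 3.11's qualitative clause).  Suppose (i) `c·⟨A,A⟩_τ ≤ ⟨A, Δ_a(U₀)A⟩_τ` for every
`A ∈ E_𝔤(Ω₀)`, and (ii) the blocks of `Δ_a(U₀)` between bonds of `Ω₀` have a majorant `|(Δ_a(U₀)δ_{b′}w)(b)|_τ ≤ A(b,b′)|w|_τ` (Hermitian `w`) whose
`(e^{κ|b−b′|_∞} − 1)`-weighted row and column sums over the bonds of `Ω₀` are `≤ ϱ < c` (`κ ≥ 0`; `|b−b′|_∞` = the `ℓ∞` distance of the base points).  Then for all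
bonds `b, b′` of `Ω₀` and every Hermitian `w`: `|(G_𝔤(U₀)δ_{b′}w)(b)|_τ ≤ e^{−κ|b−b′|_∞}·|w|_τ ∕ (c − ϱ)`.
[cite: Balaban1985BackgroundPropagators, Thm 3.3 p.399, (3.42) p.397, (3.26)–(3.27) p.395, Thm 3.11 p.416; Balaban1984PropagatorsII, p.226; Balaban1988RG2Cluster, (2.5)–(2.7) pp.12–13] -/
theorem fnorm_gopZdH_bump_le_exp_of_coercive (hΩ : Ω₀.Finite) (hτp : ∀ a : 𝔸, a ≠ 0 → 0 < (τ (star a * a)).re)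
    (hτs : ∀ a : 𝔸, τ (star a) = starRingEnd ℂ (τ a)) (hreg : RegularAtH η o Ω₀ U₀) {c κ ϱ : ℝ} (hκ : 0 ≤ κ)
    (hco : ∀ A ∈ domSubH (𝔸 := 𝔸) Ω₀, c * bondPair τ A A ≤ bondPair τ A (deltaAOf η o U₀ A))
    (Amaj : Site d × Fin d → Site d × Fin d → ℝ) (hA : ∀ b b', 0 ≤ Amaj b b')
    (hblock : ∀ b b' : Site d × Fin d, BondTouches Ω₀ b.1 b.2 → BondTouches Ω₀ b'.1 b'.2 → ∀ w : 𝔸, IsSelfAdjoint w →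
      fnorm τ (deltaAOf η o U₀ (bump b'.1 b'.2 w) b.1 b.2) ≤ Amaj b b' * fnorm τ w)
    (hrow : ∀ b : Site d × Fin d, BondTouches Ω₀ b.1 b.2 →
      ∑ b' ∈ (setOf_bondTouches_finite hΩ).toFinset, Amaj b b' * (Real.exp (κ * (linfDist b.1 b'.1 : ℝ)) - 1) ≤ ϱ)
    (hcol : ∀ b' : Site d × Fin d, BondTouches Ω₀ b'.1 b'.2 →
      ∑ b ∈ (setOf_bondTouches_finite hΩ).toFinset, Amaj b b' * (Real.exp (κ * (linfDist b.1 b'.1 : ℝ)) - 1) ≤ ϱ)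
    (hϱ : ϱ < c) {b b' : Site d × Fin d} (hb : BondTouches Ω₀ b.1 b.2) (hb' : BondTouches Ω₀ b'.1 b'.2) {w : 𝔸} (hw : IsSelfAdjoint w) :
    fnorm τ (gopZdH η o Ω₀ U₀ (bump b'.1 b'.2 w) b.1 b.2) ≤ Real.exp (-(κ * (linfDist b.1 b'.1 : ℝ))) / (c - ϱ) * fnorm τ w := by
  classical
  set S := (setOf_bondTouches_finite hΩ).toFinset with hSdef
  have hS : ∀ e ∈ S, BondTouches Ω₀ e.1 e.2 := fun e he => by
    rw [hSdef, Set.Finite.mem_toFinset] at he; exact he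
  have hS' : ∀ e : Site d × Fin d, BondTouches Ω₀ e.1 e.2 → e ∈ S := fun e he => by
    rw [hSdef, Set.Finite.mem_toFinset]; exact he
  set wH : selfAdjoint.submodule ℝ 𝔸 := ⟨w, hw⟩ with hwH
  set Φ := (deltaAEquivH η o Ω₀ U₀ hreg).toLinearMap with hΦ
  set g : domSubH (𝔸 := 𝔸) Ω₀ := (deltaAEquivH η o Ω₀ U₀ hreg).symm (bumpH Ω₀ b' wH) with hg
  -- the engine, at the dictionary of §1
  have key := bsize_coord_le_exp_of_coercive_of_rowcol (β := fibreH τ) (π := coordH Ω₀) (σ := bumpH Ω₀) (s := S) (T := Φ)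
    (fibreH_comm τ hτs) (fibreH_self_nonneg τ hτp) (sum_bumpH_coordH Ω₀ S hS hS')
    (fun i hi w' => coordH_bumpH_self Ω₀ (hS i hi) w') (fun i _ j hj hij w' => coordH_bumpH_of_ne Ω₀ (hS j hj) hij w')
    (dist := fun e e' => (linfDist e.1 e'.1 : ℝ)) (fun e => by simp) (fun e e' => by rw [LatticeNorms.linfDist_comm])
    (fun e e' e'' => by exact_mod_cast LatticeNorms.linfDist_triangle e.1 e'.1 e''.1) (c := c) hκ Amaj hA
    (fun i hi j hj w' => by
      rw [bsize_fibreH, bsize_fibreH, hΦ, blk_deltaAEquivH η o Ω₀ U₀ hreg (hS i hi) (hS j hj)]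
      exact hblock i j (hS i hi) (hS j hj) _ w'.2)
    (fun i hi => hrow i (hS i hi)) (fun j hj => hcol j (hS j hj))
    (fun A => by
      rw [hΦ, cform_deltaAEquivH_eq_bondPair η o Ω₀ U₀ τ hreg S hS', cform_fibreH_eq_bondPair Ω₀ τ S hS']
      exact hco A A.2)
    hϱ (g := g) (hS' b' hb') (w := wH) (by rw [hg, hΦ, LinearEquiv.coe_toLinearMap, LinearEquiv.apply_symm_apply]) (hS' b hb)
  rw [bsize_fibreH, bsize_fibreH, coordH_coe] at key
  rw [gopZdH_bump_eq_symm η o Ω₀ U₀ hreg hb' wH]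
  exact key

/-- ★★ **THE FINITE-RANGE FORM**: a range-`r` majorant `|(Δ_a(U₀)δ_{b′}w)(b)|_τ ≤ a|w|_τ` for `|b−b′|_∞ ≤ r`, `= 0` beyond, ball count
`#{b′ : bond of Ω₀, |b−b′|_∞ ≤ r} ≤ N`, and `aN(e^{κr} − 1) < c` ⟹ `|(G_𝔤(U₀)δ_{b′}w)(b)|_τ ≤ e^{−κ|b−b′|_∞}·|w|_τ ∕ (c − aN(e^{κr} − 1))`.
[cite: Balaban1985BackgroundPropagators, Thm 3.3 p.399, (3.42) p.397, Thm 3.11 p.416] -/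
theorem fnorm_gopZdH_bump_le_exp_of_coercive_of_range (hΩ : Ω₀.Finite) (hτp : ∀ a : 𝔸, a ≠ 0 → 0 < (τ (star a * a)).re)
    (hτs : ∀ a : 𝔸, τ (star a) = starRingEnd ℂ (τ a)) (hreg : RegularAtH η o Ω₀ U₀) {c r a κ : ℝ} {N : ℕ} (hr : 0 ≤ r) (ha : 0 ≤ a) (hκ : 0 ≤ κ)
    (hco : ∀ A ∈ domSubH (𝔸 := 𝔸) Ω₀, c * bondPair τ A A ≤ bondPair τ A (deltaAOf η o U₀ A))
    (hN : ∀ b : Site d × Fin d, BondTouches Ω₀ b.1 b.2 →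
      ((setOf_bondTouches_finite hΩ).toFinset.filter (fun b' => (linfDist b.1 b'.1 : ℝ) ≤ r)).card ≤ N)
    (hrange : ∀ b b' : Site d × Fin d, BondTouches Ω₀ b.1 b.2 → BondTouches Ω₀ b'.1 b'.2 → ∀ w : 𝔸, IsSelfAdjoint w →
      r < (linfDist b.1 b'.1 : ℝ) → deltaAOf η o U₀ (bump b'.1 b'.2 w) b.1 b.2 = 0)
    (hblock : ∀ b b' : Site d × Fin d, BondTouches Ω₀ b.1 b.2 → BondTouches Ω₀ b'.1 b'.2 → ∀ w : 𝔸, IsSelfAdjoint w →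
      fnorm τ (deltaAOf η o U₀ (bump b'.1 b'.2 w) b.1 b.2) ≤ a * fnorm τ w)
    (hϱ : a * N * (Real.exp (κ * r) - 1) < c) {b b' : Site d × Fin d} (hb : BondTouches Ω₀ b.1 b.2) (hb' : BondTouches Ω₀ b'.1 b'.2)
    {w : 𝔸} (hw : IsSelfAdjoint w) :
    fnorm τ (gopZdH η o Ω₀ U₀ (bump b'.1 b'.2 w) b.1 b.2) ≤
      Real.exp (-(κ * (linfDist b.1 b'.1 : ℝ))) / (c - a * N * (Real.exp (κ * r) - 1)) * fnorm τ w := by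
  classical
  set S := (setOf_bondTouches_finite hΩ).toFinset with hSdef
  have hS : ∀ e ∈ S, BondTouches Ω₀ e.1 e.2 := fun e he => by
    rw [hSdef, Set.Finite.mem_toFinset] at he; exact he
  refine fnorm_gopZdH_bump_le_exp_of_coercive η o U₀ τ hΩ hτp hτs hreg hκ hco (fun e e' => if (linfDist e.1 e'.1 : ℝ) ≤ r then a else 0)
    (fun e e' => by split_ifs <;> [exact ha; exact le_rfl]) (fun e e' he he' w' hw' => ?_) (fun e he => ?_) (fun e' he' => ?_) hϱ hb hb' hw
  · split_ifs with h
    · exact hblock e e' he he' w' hw'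
    · rw [hrange e e' he he' w' hw' (lt_of_not_ge h), B9Eq342CombesThomasFormZd.fnorm_zero, zero_mul]
  · exact rowsum_of_range (s := S) (dist := fun x y : Site d × Fin d => (linfDist x.1 y.1 : ℝ)) hr ha hκ (hN e he)
  · have hN' := hN e' he'
    have h := rowsum_of_range (s := S) (dist := fun x y : Site d × Fin d => (linfDist x.1 y.1 : ℝ)) hr ha hκ hN'
    refine le_trans (le_of_eq (Finset.sum_congr rfl fun x _ => ?_)) h
    simp only [LatticeNorms.linfDist_comm]

end Decay

/-! ## §4  At a cube member: the coercivity constant and the regularity are theorems (dag-n06-w4 g4, dag-n06-b g19) -/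

section Cube

variable {L : ℕ} (τ : 𝔸 →ₗ[ℂ] ℂ) [FiniteDimensional ℝ 𝔸] [Nontrivial 𝔸] (hτp : ∀ a : 𝔸, a ≠ 0 → 0 < (τ (star a * a)).re)
  (hτt : ∀ a b : 𝔸, τ (a * b) = τ (b * a)) (hτs : ∀ a : 𝔸, τ (star a) = starRingEnd ℂ (τ a))

include hτp hτt hτs in
/-- ★★★ **AT A CUBE MEMBER OF [Balaban1985RegularSpaces] (1.131), FOR THE GENUINE FOUR-LETTER `Δ_a` AT PRINT's CLASS `cubeLamBP`**: there are `α > 0` and `c > 0`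
(dag-n06-w4 g4's compactness constants, member-dependent) such that for EVERY unitary `U₀` with `pdevOn(□₀ ± 3) U₀ < α`, EVERY almost-local majorant of the
blocks of `Δ_a(U₀)` between the bonds of `□₀` with rows∕columns `≤ ϱ < c` at rate `κ ≥ 0` yields
`|(G_𝔤(U₀)δ_{b′}w)(b)|_τ ≤ e^{−κ|b−b′|_∞}·|w|_τ ∕ (c − ϱ)` — the coercivity and the regularity `RegularAtH` being THEOREMS here
(`exists_coercive_of_pdevOn_lt_cube`, `regularAtH_of_pdevOn_lt_cube`); the majorant stays displayed.
[cite: Balaban1985BackgroundPropagators, Thm 3.3 p.399, (3.42) p.397, Thm 3.11 p.416; Balaban1985RegularSpaces, (1.131) p.99, (1.7) p.77] -/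
theorem exists_fnorm_gopZdH_bump_le_exp_cube (hd2 : 2 ≤ d) (hL : 2 ≤ L) (ops₀ : ℝ → ZdIdx d L → ℕ → OpsZd d 𝔸) (M : ℝ) (i : ZdIdx d L)
    {a₀ : Site d} {Mc ρ : ℕ} (hρ : L ≤ ρ) (hΩ : i.Ω = cubeFam false L a₀ Mc ρ i.k) (hΛs : i.Λs = cubeLamS L a₀ Mc ρ i.k) {m : ℕ} (hm : m ≤ i.k) :
    ∃ α : ℝ, 0 < α ∧ ∃ c : ℝ, 0 < c ∧ ∀ U₀ : Site d → Fin d → 𝔸ˣ, (∀ x κ, U₀ x κ ∈ unitaryUnits 𝔸) →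
      pdevOn (fun i' => sqLo L a₀ ρ i.k 0 i' - 3) (fun i' => sqHi L a₀ Mc ρ i.k 0 i' + 3) U₀ < α →
      ∀ (κ ϱ : ℝ), 0 ≤ κ → ϱ < c →
      ∀ Amaj : Site d × Fin d → Site d × Fin d → ℝ, (∀ b b', 0 ≤ Amaj b b') →
        (∀ b b' : Site d × Fin d, BondTouches (i.Ω 0) b.1 b.2 → BondTouches (i.Ω 0) b'.1 b'.2 → ∀ w : 𝔸, IsSelfAdjoint w →
          fnorm τ (deltaAOf i.η (opsAllZd τ L (cubeLamBP L a₀ Mc ρ i.k) ops₀ M i m) U₀ (bump b'.1 b'.2 w) b.1 b.2) ≤ Amaj b b' * fnorm τ w) →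
        (∀ b : Site d × Fin d, BondTouches (i.Ω 0) b.1 b.2 →
          ∑ b' ∈ (setOf_bondTouches_finite (B9Thm311PosDefOpenZd.cubeMember_Ω0_finite i hΩ)).toFinset,
            Amaj b b' * (Real.exp (κ * (linfDist b.1 b'.1 : ℝ)) - 1) ≤ ϱ) →
        (∀ b' : Site d × Fin d, BondTouches (i.Ω 0) b'.1 b'.2 →
          ∑ b ∈ (setOf_bondTouches_finite (B9Thm311PosDefOpenZd.cubeMember_Ω0_finite i hΩ)).toFinset,
            Amaj b b' * (Real.exp (κ * (linfDist b.1 b'.1 : ℝ)) - 1) ≤ ϱ) →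
        ∀ b b' : Site d × Fin d, BondTouches (i.Ω 0) b.1 b.2 → BondTouches (i.Ω 0) b'.1 b'.2 → ∀ w : 𝔸, IsSelfAdjoint w →
          fnorm τ (B9Eq327GreenZdHerm.gopZdH i.η (opsAllZd τ L (cubeLamBP L a₀ Mc ρ i.k) ops₀ M i m) (i.Ω 0) U₀ (bump b'.1 b'.2 w) b.1 b.2) ≤
            Real.exp (-(κ * (linfDist b.1 b'.1 : ℝ))) / (c - ϱ) * fnorm τ w := by
  obtain ⟨α₁, hα₁, hreg⟩ := B9Thm311PerMemberCubeZdUnconditional.regularAtH_of_pdevOn_lt_cube τ hτp hτt hτs hd2 hL ops₀ M i hρ hΩ hΛs hm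
  obtain ⟨α₂, hα₂, c, hc, hcoer⟩ := B9Thm311CoerciveCompactZd.exists_coercive_of_pdevOn_lt_cube τ hτp hτt hτs hd2 hL ops₀ M i hρ hΩ hΛs hm
  refine ⟨min α₁ α₂, lt_min hα₁ hα₂, c, hc, fun U₀ hU hsmall κ ϱ hκ hϱ Amaj hA hblock hrow hcol b b' hb hb' w hw => ?_⟩
  have hfin : (i.Ω 0).Finite := B9Thm311PosDefOpenZd.cubeMember_Ω0_finite i hΩ
  exact fnorm_gopZdH_bump_le_exp_of_coercive i.η _ U₀ τ hfin hτp hτs (hreg U₀ hU (lt_of_lt_of_le hsmall (min_le_left _ _))).1 hκ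
    (hcoer U₀ hU (lt_of_lt_of_le hsmall (min_le_right _ _))) Amaj hA hblock hrow hcol hϱ hb hb' hw

end Cube

end Literature.MathematicalPhysics.QuantumFieldTheory.Balaban1983to89.B9Thm33GDecayOfCoerciveZd

end
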